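import Summits.CriticalPhenomena.PercolationContinuityZ3.Theorems.PercNearOneGluingNoHeavyLowerTailStarSetForestBaseDead
import Summits.CriticalPhenomena.PercolationContinuityZ3.Theorems.PercNearOneGluingNoHeavyLowerTailStarSetSumPattern
import HarnessLib

/-!
# `NoHeavyLowerTail` (stmt-CriticalPhenomena-4575) — mixed certificate: the FOREST lonely terms among arbitrary extra classes (pointwise brick)

Support file (prover `prim-gen-swap` gen 9; `--supports stmt-CriticalPhenomena-4575`).  No definitions, no named facts, no sorries.

Classes indexed by `Fin (Mf + Mc)`: the first `Mf` (`Fin.castAdd Mc I`) form a class FOREST in a leaf-peeling order, the last `Mc`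
(`Fin.natAdd Mf K`) are arbitrary further classes ("chords").  Seat memo MWF-CERT.md §3–§4: in the mixed certificate the lonely terms of
the forest classes are paid by the nested champion budgets of the forest, uniformly over the states of the chords.  This file proves that
brick, pointwise in a base configuration `ξ`: conditioning on the chord pattern `U` shifts the base to `ξ ∪ L_U`, where the dead-port forest
certificate `StarSet.classForest_lonely_le_champion_base_dead` applies; the pattern weights factorise by `StarSet.patternSum_sum_type`.

* `StarSet.mixed_patternSum` — `Σ_{S ⊆ Fin(Mf+Mc)} W(S) F(S) = Σ_U W_C(U) Σ_T W_F(T) F(T ⊔ U)`;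
* `StarSet.mixed_forestLonely_le` — `Σ_I W({I})·1[P_{I} lonely in ξ] ≤ Σ_{I : P I ∉ X} c_I · Σ_S W(S)·1[|π_{ξ ∪ L_S}(P I)| ≤ j]`
  (forest classes `I`, all patterns `S`, dead ports `X` never met by a lonely forest class at any base `ξ ∪ L_U`).
-/

noncomputable section

namespace Summit.CriticalPhenomena.PercolationContinuityZ3.Theorems

open MeasureTheory Set Literature.Probability.LatticeModels Literature.Probability.Percolation
open scoped Classical BigOperators

variable {n Mf Mc : ℕ}

namespace StarSet

/-- Images of a mapped disjoint sum. [folklore] -/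
theorem image_map_disjSum {γ δ : Type*} [DecidableEq δ] {α β : Type*} (T : Finset α) (U : Finset β) (e : α ⊕ β ↪ γ) (φ : γ → δ) :
    ((T.disjSum U).map e).image φ = T.image (fun a => φ (e (Sum.inl a))) ∪ U.image (fun b => φ (e (Sum.inr b))) := by
  ext x
  simp only [Finset.mem_image, Finset.mem_map, Finset.mem_union, Finset.mem_disjSum]
  constructor
  · rintro ⟨y, ⟨z, hz, rfl⟩, rfl⟩
    rcases hz with ⟨a, ha, rfl⟩ | ⟨b, hb, rfl⟩
    · exact Or.inl ⟨a, ha, rfl⟩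
    · exact Or.inr ⟨b, hb, rfl⟩
  · rintro (⟨a, ha, rfl⟩ | ⟨b, hb, rfl⟩)
    · exact ⟨e (Sum.inl a), ⟨Sum.inl a, Or.inl ⟨a, ha, rfl⟩, rfl⟩, rfl⟩
    · exact ⟨e (Sum.inr b), ⟨Sum.inr b, Or.inr ⟨b, hb, rfl⟩, rfl⟩, rfl⟩

/-- **Pattern sums over `Fin (Mf + Mc)` split into forest and chord patterns.** [folklore] -/
theorem mixed_patternSum (Θ : Fin (Mf + Mc) → ℝ) (F : Finset (Fin (Mf + Mc)) → ℝ) :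
    ∑ S ∈ (Finset.univ : Finset (Fin (Mf + Mc))).powerset, ((∏ κ ∈ S, Θ κ) * ∏ κ ∈ Finset.univ \ S, (1 - Θ κ)) * F S =
      ∑ U ∈ (Finset.univ : Finset (Fin Mc)).powerset,
        ((∏ K ∈ U, Θ (Fin.natAdd Mf K)) * ∏ K ∈ Finset.univ \ U, (1 - Θ (Fin.natAdd Mf K))) *
        ∑ T ∈ (Finset.univ : Finset (Fin Mf)).powerset,
          ((∏ I ∈ T, Θ (Fin.castAdd Mc I)) * ∏ I ∈ Finset.univ \ T, (1 - Θ (Fin.castAdd Mc I))) *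
          F ((T.disjSum U).map finSumFinEquiv.toEmbedding) := by
  set e : Fin Mf ⊕ Fin Mc ≃ Fin (Mf + Mc) := finSumFinEquiv with he
  -- (A) transport the pattern sum to the sum type
  have hA : ∑ S ∈ (Finset.univ : Finset (Fin (Mf + Mc))).powerset, ((∏ κ ∈ S, Θ κ) * ∏ κ ∈ Finset.univ \ S, (1 - Θ κ)) * F S =
      ∑ S' ∈ (Finset.univ : Finset (Fin Mf ⊕ Fin Mc)).powerset,
        ((∏ y ∈ S', Θ (e y)) * ∏ y ∈ Finset.univ \ S', (1 - Θ (e y))) * F (S'.map e.toEmbedding) := by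
    rw [Finset.powerset_univ, Finset.powerset_univ]
    refine (Fintype.sum_equiv (Equiv.finsetCongr e) _ _ fun S' => ?_).symm
    rw [Equiv.finsetCongr_apply]
    have hsd : Finset.univ \ S'.map e.toEmbedding = (Finset.univ \ S').map e.toEmbedding := by
      rw [Finset.map_sdiff, Finset.map_univ_equiv]
    rw [hsd, Finset.prod_map, Finset.prod_map]
    rfl
  rw [hA, patternSum_sum_type (fun y => Θ (e y)) (fun S' => F (S'.map e.toEmbedding))]
  simp only [he, finSumFinEquiv_apply_left, finSumFinEquiv_apply_right]

/-- **Forest lonely terms among extra classes** (see the file header).  `W({I})` for a forest class `I`, with the `c`-free loneliness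
of its ports in `ξ`, is paid by `Σ_{I' : P I' ∉ X} c_{I'} Σ_S W(S) 1[P I' light in ξ ∪ L_S]`, provided no forest class meeting a dead port
is lonely at any base `ξ ∪ L_U` (`U` a chord pattern). [this file] -/
theorem mixed_forestLonely_le (A : Finset (Fin n)) (P P' : Fin (Mf + Mc) → Fin n) (Θ : Fin (Mf + Mc) → ℝ)
    (hΘ0 : ∀ κ, 0 ≤ Θ κ) (hΘ1 : ∀ κ, Θ κ ≤ 1) (j : ℕ) (hj : j ≤ 2)
    (hPA : ∀ κ, P κ ∈ A) (hP'A : ∀ κ, P' κ ∈ A) (hPP' : ∀ κ, P κ ≠ P' κ)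
    (hforest : ∀ K I : Fin Mf, K < I → P' (Fin.castAdd Mc K) ≠ P (Fin.castAdd Mc I) ∧ P' (Fin.castAdd Mc K) ≠ P' (Fin.castAdd Mc I))
    (ξ : BondConfig (Fin n)) (X : Finset (Fin n))
    (hX : ∀ (I : Fin Mf) (U : Finset (Fin Mc)), (P (Fin.castAdd Mc I) ∈ X ∨ P' (Fin.castAdd Mc I) ∈ X) →
      ¬ (1 ≤ (A.filter fun z => ∃ u ∈ ({Fin.castAdd Mc I} : Finset (Fin (Mf + Mc))).image P ∪
              ({Fin.castAdd Mc I} : Finset (Fin (Mf + Mc))).image P',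
            (openGraph (ξ ∪ ↑(U.image fun K => (s(P (Fin.natAdd Mf K), P' (Fin.natAdd Mf K)) : Sym2 (Fin n))))).Reachable u z).card ∧
        (A.filter fun z => ∃ u ∈ ({Fin.castAdd Mc I} : Finset (Fin (Mf + Mc))).image P ∪
              ({Fin.castAdd Mc I} : Finset (Fin (Mf + Mc))).image P',
            (openGraph (ξ ∪ ↑(U.image fun K => (s(P (Fin.natAdd Mf K), P' (Fin.natAdd Mf K)) : Sym2 (Fin n))))).Reachable u z).card ≤ j)) :
    ∑ I : Fin Mf, ((∏ κ ∈ ({Fin.castAdd Mc I} : Finset (Fin (Mf + Mc))), Θ κ) *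
          ∏ κ ∈ Finset.univ \ {Fin.castAdd Mc I}, (1 - Θ κ)) *
        DecisionTree.ind {ω' : BondConfig (Fin n) |
          1 ≤ (A.filter fun z => ∃ u ∈ ({Fin.castAdd Mc I} : Finset (Fin (Mf + Mc))).image P ∪
              ({Fin.castAdd Mc I} : Finset (Fin (Mf + Mc))).image P', (openGraph ω').Reachable u z).card ∧
          (A.filter fun z => ∃ u ∈ ({Fin.castAdd Mc I} : Finset (Fin (Mf + Mc))).image P ∪
              ({Fin.castAdd Mc I} : Finset (Fin (Mf + Mc))).image P', (openGraph ω').Reachable u z).card ≤ j} ξ ≤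
      ∑ I ∈ (Finset.univ : Finset (Fin Mf)).filter (fun I => P (Fin.castAdd Mc I) ∉ X),
        (Θ (Fin.castAdd Mc I) * ∏ K ∈ Finset.univ.filter (· < I), (1 - Θ (Fin.castAdd Mc K))) *
        ∑ S ∈ (Finset.univ : Finset (Fin (Mf + Mc))).powerset, ((∏ κ ∈ S, Θ κ) * ∏ κ ∈ Finset.univ \ S, (1 - Θ κ)) *
          DecisionTree.ind {ω' : BondConfig (Fin n) |
            (A.filter fun z => (openGraph (ω' ∪ ↑(S.image fun κ => (s(P κ, P' κ) : Sym2 (Fin n))))).Reachable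
              (P (Fin.castAdd Mc I)) z).card ≤ j} ξ := by
  -- forest and chord sub-families
  set PF : Fin Mf → Fin n := fun I => P (Fin.castAdd Mc I) with hPF
  set PF' : Fin Mf → Fin n := fun I => P' (Fin.castAdd Mc I) with hPF'
  set ΘF : Fin Mf → ℝ := fun I => Θ (Fin.castAdd Mc I) with hΘF
  set ΘC : Fin Mc → ℝ := fun K => Θ (Fin.natAdd Mf K) with hΘC
  set WF : Finset (Fin Mf) → ℝ := fun T => (∏ I ∈ T, ΘF I) * ∏ I ∈ Finset.univ \ T, (1 - ΘF I) with hWF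
  set WC : Finset (Fin Mc) → ℝ := fun U => (∏ K ∈ U, ΘC K) * ∏ K ∈ Finset.univ \ U, (1 - ΘC K) with hWC
  set W : Finset (Fin (Mf + Mc)) → ℝ := fun S => (∏ κ ∈ S, Θ κ) * ∏ κ ∈ Finset.univ \ S, (1 - Θ κ) with hW
  set cfF : Fin Mf → ℝ := fun I => ΘF I * ∏ K ∈ Finset.univ.filter (· < I), (1 - ΘF K) with hcfF
  have hWFnn : ∀ T, 0 ≤ WF T := fun T => mul_nonneg (Finset.prod_nonneg fun I _ => hΘ0 _) (Finset.prod_nonneg fun I _ => sub_nonneg.2 (hΘ1 _))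
  have hWCnn : ∀ U, 0 ≤ WC U := fun U => mul_nonneg (Finset.prod_nonneg fun K _ => hΘ0 _) (Finset.prod_nonneg fun K _ => sub_nonneg.2 (hΘ1 _))
  have hcfFnn : ∀ I, 0 ≤ cfF I := fun I => mul_nonneg (hΘ0 _) (Finset.prod_nonneg fun K _ => sub_nonneg.2 (hΘ1 _))
  set LC : Finset (Fin Mc) → Set (Sym2 (Fin n)) := fun U => ↑(U.image fun K => (s(P (Fin.natAdd Mf K), P' (Fin.natAdd Mf K)) : Sym2 (Fin n))) with hLC
  set LF : Finset (Fin Mf) → Set (Sym2 (Fin n)) := fun T => ↑(T.image fun I => (s(PF I, PF' I) : Sym2 (Fin n))) with hLF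
  -- links of a mixed pattern
  have hlinks : ∀ (T : Finset (Fin Mf)) (U : Finset (Fin Mc)),
      (↑(((T.disjSum U).map finSumFinEquiv.toEmbedding).image fun κ => (s(P κ, P' κ) : Sym2 (Fin n))) : Set (Sym2 (Fin n))) = LF T ∪ LC U := by
    intro T U
    rw [image_map_disjSum, Finset.coe_union]
    simp only [hLF, hLC, hPF, hPF', Equiv.toEmbedding_apply, finSumFinEquiv_apply_left, finSumFinEquiv_apply_right]
  -- the lonely indicator and the lightness indicator
  set lonelyF : BondConfig (Fin n) → Finset (Fin Mf) → ℝ := fun ω₀ T => DecisionTree.ind {ω' : BondConfig (Fin n) |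
    1 ≤ (A.filter fun z => ∃ u ∈ T.image PF ∪ T.image PF', (openGraph ω').Reachable u z).card ∧
    (A.filter fun z => ∃ u ∈ T.image PF ∪ T.image PF', (openGraph ω').Reachable u z).card ≤ j} ω₀ with hlonelyF
  set lightF : BondConfig (Fin n) → Fin Mf → Finset (Fin Mf) → ℝ := fun ω₀ I T => DecisionTree.ind {ω' : BondConfig (Fin n) |
    (A.filter fun z => (openGraph (ω' ∪ ↑(T.image fun I => (s(PF I, PF' I) : Sym2 (Fin n))))).Reachable (PF I) z).card ≤ j} ω₀ with hlightF
  -- (1) the dead-port forest certificate at each base `ξ ∪ LC U`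
  have hbrick : ∀ U : Finset (Fin Mc),
      ∑ T ∈ (Finset.univ : Finset (Fin Mf)).powerset, WF T * lonelyF (ξ ∪ LC U) T ≤
        ∑ I ∈ Finset.univ.filter (fun I => PF I ∉ X), cfF I * ∑ T ∈ (Finset.univ : Finset (Fin Mf)).powerset, WF T * lightF (ξ ∪ LC U) I T := by
    intro U
    have hXU : ∀ I : Fin Mf, (PF I ∈ X ∨ PF' I ∈ X) →
        ¬ (1 ≤ (A.filter fun z => ∃ u ∈ ({I} : Finset (Fin Mf)).image PF ∪ ({I} : Finset (Fin Mf)).image PF',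
            (openGraph (ξ ∪ LC U)).Reachable u z).card ∧
          (A.filter fun z => ∃ u ∈ ({I} : Finset (Fin Mf)).image PF ∪ ({I} : Finset (Fin Mf)).image PF',
            (openGraph (ξ ∪ LC U)).Reachable u z).card ≤ j) := by
      intro I hI h
      refine hX I U hI ⟨h.1.trans_eq (card_filter_congr fun z _ => ?_), (card_filter_congr fun z _ => ?_).trans_le h.2⟩
      all_goals
        simp only [Finset.image_singleton, Finset.mem_union, Finset.mem_singleton, hPF, hPF', hLC]
    exact classForest_lonely_le_champion_base_dead A PF PF' ΘF (fun I => hΘ0 _) (fun I => hΘ1 _) j hj (fun I => hPA _) (fun I => hP'A _)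
      (fun I => hPP' _) hforest (ξ ∪ LC U) X hXU
  -- (2) average over the chord patterns
  have hsum : ∑ U ∈ (Finset.univ : Finset (Fin Mc)).powerset, WC U * ∑ T ∈ (Finset.univ : Finset (Fin Mf)).powerset, WF T * lonelyF (ξ ∪ LC U) T ≤
      ∑ U ∈ (Finset.univ : Finset (Fin Mc)).powerset, WC U *
        ∑ I ∈ Finset.univ.filter (fun I => PF I ∉ X), cfF I * ∑ T ∈ (Finset.univ : Finset (Fin Mf)).powerset, WF T * lightF (ξ ∪ LC U) I T :=
    Finset.sum_le_sum fun U _ => mul_le_mul_of_nonneg_left (hbrick U) (hWCnn U)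
  -- (3) the right-hand side is the mixed pattern sum
  have hR : ∀ I : Fin Mf, ∑ S ∈ (Finset.univ : Finset (Fin (Mf + Mc))).powerset, W S *
        DecisionTree.ind {ω' : BondConfig (Fin n) |
          (A.filter fun z => (openGraph (ω' ∪ ↑(S.image fun κ => (s(P κ, P' κ) : Sym2 (Fin n))))).Reachable (P (Fin.castAdd Mc I)) z).card ≤ j} ξ =
      ∑ U ∈ (Finset.univ : Finset (Fin Mc)).powerset, WC U * ∑ T ∈ (Finset.univ : Finset (Fin Mf)).powerset, WF T * lightF (ξ ∪ LC U) I T := by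
    intro I
    rw [mixed_patternSum Θ]
    refine Finset.sum_congr rfl fun U _ => ?_
    congr 1
    refine Finset.sum_congr rfl fun T _ => ?_
    congr 1
    simp only [hlightF]
    have hset : {ω' : BondConfig (Fin n) | (A.filter fun z => (openGraph (ω' ∪
        ↑(((T.disjSum U).map finSumFinEquiv.toEmbedding).image fun κ => (s(P κ, P' κ) : Sym2 (Fin n))))).Reachable
          (P (Fin.castAdd Mc I)) z).card ≤ j} =
        {ω' : BondConfig (Fin n) | (A.filter fun z => (openGraph ((ω' ∪ LC U) ∪ LF T)).Reachable (PF I) z).card ≤ j} := by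
      ext ω'
      simp only [mem_setOf_eq, hlinks T U, hPF]
      rw [Set.union_comm (LF T) (LC U), ← Set.union_assoc]
    rw [hset]
    by_cases hmem : ξ ∈ {ω' : BondConfig (Fin n) | (A.filter fun z => (openGraph ((ω' ∪ LC U) ∪ LF T)).Reachable (PF I) z).card ≤ j}
    · rw [DecisionTree.ind_of_mem hmem, DecisionTree.ind_of_mem (by simpa only [mem_setOf_eq] using hmem)]
    · rw [DecisionTree.ind_of_not_mem hmem, DecisionTree.ind_of_not_mem (by simpa only [mem_setOf_eq] using hmem)]
  -- (4) the left-hand side: chord pattern `∅`, forest singletons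
  have hL : ∀ I : Fin Mf, ((∏ κ ∈ ({Fin.castAdd Mc I} : Finset (Fin (Mf + Mc))), Θ κ) *
        ∏ κ ∈ Finset.univ \ {Fin.castAdd Mc I}, (1 - Θ κ)) *
      DecisionTree.ind {ω' : BondConfig (Fin n) |
        1 ≤ (A.filter fun z => ∃ u ∈ ({Fin.castAdd Mc I} : Finset (Fin (Mf + Mc))).image P ∪
            ({Fin.castAdd Mc I} : Finset (Fin (Mf + Mc))).image P', (openGraph ω').Reachable u z).card ∧
        (A.filter fun z => ∃ u ∈ ({Fin.castAdd Mc I} : Finset (Fin (Mf + Mc))).image P ∪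
            ({Fin.castAdd Mc I} : Finset (Fin (Mf + Mc))).image P', (openGraph ω').Reachable u z).card ≤ j} ξ =
      WC ∅ * (WF {I} * lonelyF (ξ ∪ LC ∅) {I}) := by
    intro I
    have hne : ∀ (K : Fin Mc) (I' : Fin Mf), Fin.natAdd Mf K ≠ Fin.castAdd Mc I' := by
      intro K I' h
      have := congrArg Fin.val h
      simp only [Fin.val_natAdd, Fin.val_castAdd] at this
      omega
    have hw : (∏ κ ∈ ({Fin.castAdd Mc I} : Finset (Fin (Mf + Mc))), Θ κ) * ∏ κ ∈ Finset.univ \ {Fin.castAdd Mc I}, (1 - Θ κ) =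
        WC ∅ * WF {I} := by
      have h1 : ∏ κ ∈ Finset.univ \ ({Fin.castAdd Mc I} : Finset (Fin (Mf + Mc))), (1 - Θ κ) =
          ∏ κ, (if κ = Fin.castAdd Mc I then (1 : ℝ) else (1 - Θ κ)) := by
        rw [← Finset.prod_sdiff (Finset.subset_univ ({Fin.castAdd Mc I} : Finset (Fin (Mf + Mc)))), Finset.prod_singleton,
          if_pos rfl, mul_one]
        exact Finset.prod_congr rfl fun κ hκ => by
          rw [if_neg (by simpa only [Finset.mem_sdiff, Finset.mem_univ, true_and, Finset.mem_singleton] using hκ)]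
      have h2 : ∏ I' ∈ Finset.univ \ ({I} : Finset (Fin Mf)), (1 - ΘF I') = ∏ I', (if I' = I then (1 : ℝ) else (1 - ΘF I')) := by
        rw [← Finset.prod_sdiff (Finset.subset_univ ({I} : Finset (Fin Mf))), Finset.prod_singleton, if_pos rfl, mul_one]
        exact Finset.prod_congr rfl fun I' hI' => by
          rw [if_neg (by simpa only [Finset.mem_sdiff, Finset.mem_univ, true_and, Finset.mem_singleton] using hI')]
      have hsplit : ∏ κ, (if κ = Fin.castAdd Mc I then (1 : ℝ) else (1 - Θ κ)) =
          (∏ I', (if I' = I then (1 : ℝ) else (1 - ΘF I'))) * ∏ K : Fin Mc, (1 - ΘC K) := by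
        rw [Fin.prod_univ_add]
        congr 1
        · exact Finset.prod_congr rfl fun I' _ => by simp only [hΘF, Fin.castAdd_inj]
        · exact Finset.prod_congr rfl fun K _ => by rw [if_neg (hne K I)]
      simp only [hWC, hWF, hΘC, Finset.prod_singleton, Finset.prod_empty, Finset.sdiff_empty, one_mul]
      rw [h1, hsplit, h2]
      ring
    have hind : DecisionTree.ind {ω' : BondConfig (Fin n) |
        1 ≤ (A.filter fun z => ∃ u ∈ ({Fin.castAdd Mc I} : Finset (Fin (Mf + Mc))).image P ∪
            ({Fin.castAdd Mc I} : Finset (Fin (Mf + Mc))).image P', (openGraph ω').Reachable u z).card ∧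
        (A.filter fun z => ∃ u ∈ ({Fin.castAdd Mc I} : Finset (Fin (Mf + Mc))).image P ∪
            ({Fin.castAdd Mc I} : Finset (Fin (Mf + Mc))).image P', (openGraph ω').Reachable u z).card ≤ j} ξ =
        lonelyF (ξ ∪ LC ∅) {I} := by
      have hLC0 : ξ ∪ LC ∅ = ξ := by simp [hLC]
      simp only [hlonelyF, hLC0]
      have hiff : ∀ z, (∃ u ∈ ({Fin.castAdd Mc I} : Finset (Fin (Mf + Mc))).image P ∪ ({Fin.castAdd Mc I} : Finset (Fin (Mf + Mc))).image P',
          (openGraph ξ).Reachable u z) ↔ (∃ u ∈ ({I} : Finset (Fin Mf)).image PF ∪ ({I} : Finset (Fin Mf)).image PF', (openGraph ξ).Reachable u z) := by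
        intro z; simp only [Finset.image_singleton, Finset.mem_union, Finset.mem_singleton, hPF, hPF']
      by_cases hmem : ξ ∈ {ω' : BondConfig (Fin n) |
          1 ≤ (A.filter fun z => ∃ u ∈ ({I} : Finset (Fin Mf)).image PF ∪ ({I} : Finset (Fin Mf)).image PF', (openGraph ω').Reachable u z).card ∧
          (A.filter fun z => ∃ u ∈ ({I} : Finset (Fin Mf)).image PF ∪ ({I} : Finset (Fin Mf)).image PF', (openGraph ω').Reachable u z).card ≤ j}
      · rw [DecisionTree.ind_of_mem hmem, DecisionTree.ind_of_mem]
        simp only [mem_setOf_eq] at hmem ⊢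
        exact ⟨hmem.1.trans_eq (card_filter_congr fun z _ => (hiff z).symm), (card_filter_congr fun z _ => hiff z).trans_le hmem.2⟩
      · rw [DecisionTree.ind_of_not_mem hmem, DecisionTree.ind_of_not_mem]
        intro h
        apply hmem
        simp only [mem_setOf_eq] at h ⊢
        exact ⟨h.1.trans_eq (card_filter_congr fun z _ => hiff z), (card_filter_congr fun z _ => (hiff z).symm).trans_le h.2⟩
    rw [hw, hind, mul_assoc]
  have hLle : ∑ I : Fin Mf, WC ∅ * (WF {I} * lonelyF (ξ ∪ LC ∅) {I}) ≤
      ∑ U ∈ (Finset.univ : Finset (Fin Mc)).powerset, WC U * ∑ T ∈ (Finset.univ : Finset (Fin Mf)).powerset, WF T * lonelyF (ξ ∪ LC U) T := by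
    rw [← Finset.mul_sum]
    have h1 : ∑ I : Fin Mf, WF {I} * lonelyF (ξ ∪ LC ∅) {I} ≤ ∑ T ∈ (Finset.univ : Finset (Fin Mf)).powerset, WF T * lonelyF (ξ ∪ LC ∅) T := by
      have hsub : (Finset.univ : Finset (Fin Mf)).image (fun I => ({I} : Finset (Fin Mf))) ⊆ (Finset.univ : Finset (Fin Mf)).powerset :=
        fun T _ => Finset.mem_powerset.2 (Finset.subset_univ _)
      rw [← Finset.sum_image (f := fun T => WF T * lonelyF (ξ ∪ LC ∅) T) (fun a _ b _ h => Finset.singleton_injective h)]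
      exact Finset.sum_le_sum_of_subset_of_nonneg hsub fun T _ _ => mul_nonneg (hWFnn T) (DecisionTree.ind_nonneg _ _)
    have h2 : WC ∅ * ∑ T ∈ (Finset.univ : Finset (Fin Mf)).powerset, WF T * lonelyF (ξ ∪ LC ∅) T ≤
        ∑ U ∈ (Finset.univ : Finset (Fin Mc)).powerset, WC U * ∑ T ∈ (Finset.univ : Finset (Fin Mf)).powerset, WF T * lonelyF (ξ ∪ LC U) T := by
      have := Finset.single_le_sum (f := fun U => WC U * ∑ T ∈ (Finset.univ : Finset (Fin Mf)).powerset, WF T * lonelyF (ξ ∪ LC U) T)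
        (fun U _ => mul_nonneg (hWCnn U) (Finset.sum_nonneg fun T _ => mul_nonneg (hWFnn T) (DecisionTree.ind_nonneg _ _)))
        (Finset.mem_powerset.2 (Finset.empty_subset (Finset.univ : Finset (Fin Mc))))
      simpa using this
    exact le_trans (mul_le_mul_of_nonneg_left h1 (hWCnn ∅)) h2
  -- assemble
  calc ∑ I : Fin Mf, ((∏ κ ∈ ({Fin.castAdd Mc I} : Finset (Fin (Mf + Mc))), Θ κ) * ∏ κ ∈ Finset.univ \ {Fin.castAdd Mc I}, (1 - Θ κ)) * _
      = ∑ I : Fin Mf, WC ∅ * (WF {I} * lonelyF (ξ ∪ LC ∅) {I}) := Finset.sum_congr rfl fun I _ => hL I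
    _ ≤ _ := hLle
    _ ≤ _ := hsum
    _ = ∑ I ∈ Finset.univ.filter (fun I => PF I ∉ X), cfF I *
          ∑ U ∈ (Finset.univ : Finset (Fin Mc)).powerset, WC U * ∑ T ∈ (Finset.univ : Finset (Fin Mf)).powerset, WF T * lightF (ξ ∪ LC U) I T := by
        simp only [Finset.mul_sum]
        rw [Finset.sum_comm]
        refine Finset.sum_congr rfl fun I _ => Finset.sum_congr rfl fun U _ => Finset.sum_congr rfl fun T _ => ?_
        ring
    _ = _ := by
        refine Finset.sum_congr rfl fun I _ => ?_
        rw [hR I]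

end StarSet

end Summit.CriticalPhenomena.PercolationContinuityZ3.Theorems

end
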